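import Mathlib
import Literature.Analysis.FluidPDE.ClassicalEarlyWindowBound
import Summits.NavierStokesRegularity.NavierStokesRegularity.Theses.LevelSetModeration

/-!
# Route LevelSetModeration — crux 2 `HighSpeedPressureWork`: the early window of the data class

Support lemma for item stmt-NavierStokesRegularity-18149
(`Summit.NavierStokesRegularity.NavierStokesRegularity.Theses.LevelSetModeration.HighSpeedPressureWork`).
The crux quantifies over the data class `(ν, T, E₀, B₀)`: classical solutions on `ℝ³ × [0,T)` that are
Leray–Hopf from a rapidly decaying datum with `∫|u₀|² ≤ E₀`, `|u₀| ≤ B₀`, and over levels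
`c ∈ [M/2, M]`, `M ≥ 2B₀`. The landed Literature theorem `exists_earlyWindow_norm_le`
(Kato–Oseen local theory for bounded data + Kato solutions are Leray–Hopf + Prodi–Serrin weak–strong
uniqueness) gives the class-uniform EARLY WINDOW in exactly this vocabulary:

* `levelSetModeration_earlyWindow` — one absolute `c₀ > 0`: for every member of the class and every
  `t ∈ [0, T)` with `t < c₀ν/B₀²`, `‖u(t, x)‖ ≤ 2B₀` for all `x`, and every super-level set
  `{x | c < ‖u(t, x)‖}` with `c ≥ 2B₀` — in particular the top level `c = M` of the crux — is EMPTY.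

This is the "early window / no flash before `c₀ν/B₀²`" input named by every line of the crux
(STRATEGY-CENSUS D2/D5; `linear_closure` L3 first half; `iso-speed-area-closure` EarlyWindowBound;
`comoving-epsilon-regularity-split` O-early-window), now a theorem.
-/

noncomputable section

-- single-conjunct summit: `Summit.<Summit>.<Problem>` repeats the name by the D-0017 layout
set_option linter.dupNamespace false

namespace Summit.NavierStokesRegularity.NavierStokesRegularity.Theorems

open MeasureTheory Set
open Literature.Analysis.FluidPDE

/-- **The early window of the data class.** There is an absolute constant `c₀ > 0` such that every
classical solution of the unforced Navier–Stokes system on `ℝ³ × [0, T)` (`ν > 0`) that is Leray–Hopf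
from a rapidly decaying datum with `‖u(0, x)‖ ≤ B₀` (`B₀ > 0`) satisfies, for every `t ∈ [0, T)` with
`t < c₀ ν / B₀²`: `‖u(t, x)‖ ≤ 2B₀` for all `x`, and `{x | c < ‖u(t, x)‖} = ∅` for every level
`c ≥ 2B₀` (`exists_earlyWindow_norm_le`; the rapid-decay hypothesis is not used). [folklore] -/
theorem levelSetModeration_earlyWindow :
    ∃ c₀ : ℝ, 0 < c₀ ∧ ∀ (ν T : ℝ) (u : ℝ → EuclideanSpace ℝ (Fin 3) → EuclideanSpace ℝ (Fin 3)) (p : ℝ → EuclideanSpace ℝ (Fin 3) → ℝ), 0 < ν → 0 < T → Literature.Analysis.FluidPDE.IsClassicalNSSolutionOn (Set.Ico 0 T) ν 0 u p → Literature.Analysis.FluidPDE.IsLerayHopfOn T ν 0 (u 0) u → Literature.Analysis.FluidPDE.HasRapidSpatialDecay (u 0) → ∀ (B₀ : ℝ), 0 < B₀ → (∀ x, ‖u 0 x‖ ≤ B₀) → ∀ t ∈ Set.Ico 0 T, t < c₀ * ν / B₀ ^ 2 → (∀ x, ‖u t x‖ ≤ 2 * B₀) ∧ ∀ c : ℝ,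 2 * B₀ ≤ c → {x | c < ‖u t x‖} = ∅ := by
  obtain ⟨c₀, hc₀, h⟩ := exists_earlyWindow_norm_le
  refine ⟨c₀, hc₀, ?_⟩
  intro ν T u p hν hT hcl hLH _hdec B₀ hB₀ hbd t ht htc
  have hb : ∀ x, ‖u t x‖ ≤ 2 * B₀ := h ν T u p hν hT hcl hLH B₀ hB₀ hbd t ht htc
  refine ⟨hb, fun c hc => ?_⟩
  ext x
  simp only [mem_setOf_eq, mem_empty_iff_false, iff_false, not_lt]
  exact (hb x).trans hc

end Summit.NavierStokesRegularity.NavierStokesRegularity.Theorems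

end
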